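import Summits.Ventures.PercRepro.RankLevelSetLevelSixBasisTail
import Summits.Ventures.PercRepro.RankLevelSetLevelSixCapGlue25
import Summits.Ventures.PercRepro.RankLevelSetCoreSixLowSelf
import Summits.Ventures.PercRepro.RankLevelSetLevelSixGiant
import Summits.Ventures.PercRepro.RankLevelSetLevelSixBasisRegII24

/-!
# PercRepro — REGIME II AT RANK `23` BY THE BASIS DEVICE: EVERY CORANK `d ≥ 39` (p8 g11, S3)

`proofs/SUBCLAIM-S3-p8.md` §3y. RankLevelSetLevelSixBasisRegII24 (p8 g10) at rank `23`. On the `e`-free core of rank `23` and corank `d`, `#U ≤ #{r = 6, |B| ≤ d}` and every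
rank-`6` set lies in its closure of `≤ 39` points, so THE BASIS DEVICE at `c = t = 39` gives `#U ≤ G₃₉·C(n, 6)` and
`#{r = 6} ≤ G₃₉·C(n, 6)` with `G₃₉ = 91625857660/236379` (the maximum of `720·Σ_{i ∈ [6, 39]} C(m, i)/∏_{k<6} max(m − flatCap k, 1)`
over `6 ≤ m ≤ 39`, `basis_G39`); with `#{r ≤ 5}` by `ncard_eRk_le_five_le_basis` and night-1's `C(n, 22) ≤ #Y + #{r ≤ 6}`,
the cell reads `2^{29}/C(29, 6)·G₃₉·C(n, 6) + tail₅(n) + G₃₉·C(n, 6) ≤ C(n, 22)` — ONE numeral at `n₀ = 62` (ratio `0.786`)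
propagated to every `n ≥ 62` by the termwise growth `C(n + 1, i)·(n − 21) ≤ C(n, i)·(n + 1)` for `i ≤ 6` against
`C(n + 1, 22)·(n − 21) = C(n, 22)·(n + 1)` (`regII_basis_23_numeral`). No cube cells, no key. Axioms: standard.
-/

open scoped Matroid

namespace PercRepro

namespace ThmN

open Set

variable {α : Type}

/-- **Termwise growth**: `C(n + 1, i)·(n − 21) ≤ C(n, i)·(n + 1)` for `i ≤ 22 ≤ n`. -/
theorem choose_succ_mul_sub_le_22 (n i : ℕ) (hi : i ≤ 22) (hn : 22 ≤ n) :
    (n + 1).choose i * (n - 21) ≤ n.choose i * (n + 1) := by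
  rw [Nat.choose_mul_succ_eq n i]
  exact Nat.mul_le_mul_left _ (by omega)

/-- `C(n + 1, 22)·(n − 21) = C(n, 22)·(n + 1)` for `n ≥ 22`. -/
theorem choose_succ_mul_sub_eq_22 (n : ℕ) (hn : 22 ≤ n) :
    (n + 1).choose 22 * (n - 21) = n.choose 22 * (n + 1) := by
  rw [Nat.choose_mul_succ_eq n 22, show n + 1 - 22 = n - 21 by omega]

set_option maxHeartbeats 4000000 in
/-- **The regime-II numeral at rank `23` for every `n ≥ 62`**:
`2^{29}/C(29, 6)·G₃₉·C(n, 6) + tail₅(n) + G₃₉·C(n, 6) ≤ C(n, 22)`. -/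
theorem regII_basis_23_numeral (n : ℕ) (hn : 62 ≤ n) :
    ((2 : ℚ) ^ (23 + 6) / (((23 + 6).choose 6 : ℕ) : ℚ)) * ((91625857660 / 236379 : ℚ) * ((n.choose 6 : ℕ) : ℚ)) +
      (1 + (n : ℚ) + (4 / 3 : ℚ) * ((n.choose 2 : ℕ) : ℚ) + (14 / 5 : ℚ) * ((n.choose 3 : ℕ) : ℚ) +
        (64 / 7 : ℚ) * ((n.choose 4 : ℕ) : ℚ) + (216355 / 2223 : ℚ) * ((n.choose 5 : ℕ) : ℚ)) +
      (91625857660 / 236379 : ℚ) * ((n.choose 6 : ℕ) : ℚ) ≤ ((n.choose 22 : ℕ) : ℚ) := by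
  induction n, hn using Nat.le_induction with
  | base => norm_num [Nat.choose]
  | succ n hn ih =>
    obtain ⟨k, rfl⟩ : ∃ k, n = k + 62 := ⟨n - 62, by omega⟩
    have hpos : (0 : ℚ) < ((k + 41 : ℕ) : ℚ) := by positivity
    have tt : ∀ i, i ≤ 22 → (((k + 62 + 1).choose i : ℕ) : ℚ) * ((k + 41 : ℕ) : ℚ) ≤
        (((k + 62).choose i : ℕ) : ℚ) * ((k + 63 : ℕ) : ℚ) := by
      intro i hi
      have := choose_succ_mul_sub_le_22 (k + 62) i hi (by omega)
      rw [show k + 62 - 21 = k + 41 by omega, show k + 62 + 1 = k + 63 by omega] at this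
      rw [show k + 62 + 1 = k + 63 by omega]
      exact_mod_cast this
    have t2 := tt 2 (by norm_num)
    have t3 := tt 3 (by norm_num)
    have t4 := tt 4 (by norm_num)
    have t5 := tt 5 (by norm_num)
    have t6 := tt 6 (by norm_num)
    have t23 : (((k + 62 + 1).choose 22 : ℕ) : ℚ) * ((k + 41 : ℕ) : ℚ) =
        (((k + 62).choose 22 : ℕ) : ℚ) * ((k + 63 : ℕ) : ℚ) := by
      have := choose_succ_mul_sub_eq_22 (k + 62) (by omega)
      rw [show k + 62 - 21 = k + 41 by omega, show k + 62 + 1 = k + 63 by omega] at this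
      rw [show k + 62 + 1 = k + 63 by omega]
      exact_mod_cast this
    have tn : (1 + ((k + 62 + 1 : ℕ) : ℚ)) * ((k + 41 : ℕ) : ℚ) ≤ (1 + ((k + 62 : ℕ) : ℚ)) * ((k + 63 : ℕ) : ℚ) := by
      push_cast
      nlinarith [sq_nonneg ((k : ℚ) + 1)]
    have ih' := mul_le_mul_of_nonneg_right ih (by positivity : (0 : ℚ) ≤ ((k + 63 : ℕ) : ℚ))
    refine le_of_mul_le_mul_right ?_ hpos
    rw [t23]
    have hc : (0 : ℚ) ≤ (2 : ℚ) ^ (23 + 6) / (((23 + 6).choose 6 : ℕ) : ℚ) :=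
      div_nonneg (pow_nonneg (by norm_num) _) (Nat.cast_nonneg _)
    have e6 := mul_le_mul_of_nonneg_left t6 hc
    linarith [t2, t3, t4, t5, t6, tn, ih', e6]

set_option maxHeartbeats 2000000 in
/-- **Regime II at rank `23` by the basis device**: the `e`-free core of rank `23` and corank `d ≥ 39`. -/
theorem c025_core_six_regII_basis_23 (M : Matroid α) [M.Finite] (d : ℕ) (hd : 39 ≤ d)
    (hR : M.eRank = (23 : ℕ)) (hn : M.E.ncard = 23 + d)
    (hfree : ∀ e ∈ M.E, ∃ A ⊆ M.E \ {e}, e ∉ M.closure A ∧ e ∉ M.closure ((M.E \ {e}) \ A)) :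
    RLS M 23 6 := by
  classical
  have hEcard : M.ground_finite.toFinset.card = 23 + d := by
    rw [← Set.ncard_eq_toFinset_card _ M.ground_finite]; exact hn
  have hd' : M.E.encard = M.eRank + d := by
    rw [hR, ← M.ground_finite.cast_ncard_eq, hn]
    push_cast; ring
  have hfcap := flatCap_bound M hfree
  have hf6 : ∀ k : ℕ, k < 6 → ∀ X ⊆ M.E, M.eRk X ≤ (k : ℕ∞) → X.ncard ≤ flatCap k :=
    fun k hk => hfcap k (by omega)
  have h39 : ∀ X ⊆ M.E, M.eRk X ≤ 6 → X.ncard ≤ 39 := by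
    intro X hX hr
    have := hfcap 6 le_rfl X hX (by exact_mod_cast hr)
    simpa [flatCap] using this
  -- every rank-`6` set lies in its closure of `≤ 39` points
  have hsub : ∀ S : Set (Set α), (∀ B ∈ S, B ⊆ M.E ∧ M.eRk B = (6 : ℕ)) →
      S ⊆ {B : Set α | B ⊆ M.E ∧ M.eRk B = ((6 : ℕ) : ℕ∞) ∧ B.ncard ≤ 39 ∧ (M.closure B).ncard ≤ 39} := by
    intro S hS B hB
    obtain ⟨hBE, hBr⟩ := hS B hB
    have hcl : (M.closure B).ncard ≤ 39 :=
      h39 _ (M.closure_subset_ground B) (by rw [M.eRk_closure_eq, hBr]; norm_num)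
    refine ⟨hBE, hBr, ?_, hcl⟩
    have hfin : (M.closure B).Finite := M.ground_finite.subset (M.closure_subset_ground B)
    exact (Set.ncard_le_ncard (M.subset_closure B hBE) hfin).trans hcl
  have hdev := Matroid.ncard_eRk_eq_ncard_le_closure_le_le (M := M) 6 39 39 flatCap hf6
    (91625857660 / 236379 : ℚ) (by norm_num) basis_G39
  rw [hn] at hdev
  have hfinS : ∀ S : Set (Set α), S ⊆ {B : Set α | B ⊆ M.E} → S.Finite :=
    fun S hS => M.ground_finite.finite_subsets.subset hS
  -- (U)
  have hU1 := Matroid.topCount_le_ncard_compl (M := M) hR hd' 6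
  have hUq : (Matroid.topCount M 23 6 : ℚ) ≤ (91625857660 / 236379 : ℚ) * (((23 + d).choose 6 : ℕ) : ℚ) := by
    have h1 : (Matroid.topCount M 23 6 : ℚ) ≤
        ({B : Set α | B ⊆ M.E ∧ M.eRk B = (6 : ℕ) ∧ B.ncard ≤ d}.ncard : ℚ) := by exact_mod_cast hU1
    have h2 := Set.ncard_le_ncard (hsub {B : Set α | B ⊆ M.E ∧ M.eRk B = (6 : ℕ) ∧ B.ncard ≤ d}
      (fun B hB => ⟨hB.1, hB.2.1⟩)) (hfinS _ (fun B hB => hB.1))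
    have h2q : ({B : Set α | B ⊆ M.E ∧ M.eRk B = (6 : ℕ) ∧ B.ncard ≤ d}.ncard : ℚ) ≤
        ({B : Set α | B ⊆ M.E ∧ M.eRk B = ((6 : ℕ) : ℕ∞) ∧ B.ncard ≤ 39 ∧ (M.closure B).ncard ≤ 39}.ncard : ℚ) := by
      exact_mod_cast h2
    exact h1.trans (h2q.trans hdev)
  -- (A) the rank-`≤ 6` sets
  have hT5 := ncard_eRk_le_five_le_basis M hfree
  rw [hn] at hT5
  have hsp6 := ncard_eRk_le_succ_le M 5
  have h6 : ({X : Set α | X ⊆ M.E ∧ M.eRk X = ((5 + 1 : ℕ) : ℕ∞)}.ncard : ℚ) ≤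
      (91625857660 / 236379 : ℚ) * (((23 + d).choose 6 : ℕ) : ℚ) := by
    have h2 := Set.ncard_le_ncard (hsub {X : Set α | X ⊆ M.E ∧ M.eRk X = ((5 + 1 : ℕ) : ℕ∞)}
      (fun B hB => ⟨hB.1, hB.2⟩)) (hfinS _ (fun B hB => hB.1))
    have h2q : ({X : Set α | X ⊆ M.E ∧ M.eRk X = ((5 + 1 : ℕ) : ℕ∞)}.ncard : ℚ) ≤
        ({B : Set α | B ⊆ M.E ∧ M.eRk B = ((6 : ℕ) : ℕ∞) ∧ B.ncard ≤ 39 ∧ (M.closure B).ncard ≤ 39}.ncard : ℚ) := by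
      exact_mod_cast h2
    exact h2q.trans hdev
  have hAq : ({X : Set α | X ⊆ M.E ∧ M.eRk X ≤ ((5 + 1 : ℕ) : ℕ∞)}.ncard : ℚ) ≤
      (1 + ((23 + d : ℕ) : ℚ) + (4 / 3 : ℚ) * (((23 + d).choose 2 : ℕ) : ℚ) + (14 / 5 : ℚ) * (((23 + d).choose 3 : ℕ) : ℚ) +
        (64 / 7 : ℚ) * (((23 + d).choose 4 : ℕ) : ℚ) + (216355 / 2223 : ℚ) * (((23 + d).choose 5 : ℕ) : ℚ)) +
      (91625857660 / 236379 : ℚ) * (((23 + d).choose 6 : ℕ) : ℚ) := by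
    have e1 : ({X : Set α | X ⊆ M.E ∧ M.eRk X ≤ ((5 + 1 : ℕ) : ℕ∞)}.ncard : ℚ) ≤
        ({X : Set α | X ⊆ M.E ∧ M.eRk X ≤ ((5 : ℕ) : ℕ∞)}.ncard : ℚ) +
          ({X : Set α | X ⊆ M.E ∧ M.eRk X = ((5 + 1 : ℕ) : ℕ∞)}.ncard : ℚ) := by exact_mod_cast hsp6
    exact e1.trans (add_le_add hT5 h6)
  -- (Y)
  have hY := choose_le_midCount_add_low' (M := M) (p := 23) (q := 6) (by norm_num)
  rw [hEcard] at hY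
  have hYq : (((23 + d).choose (23 - 1) : ℕ) : ℚ) ≤ (Matroid.midCount M 23 6 : ℚ) +
      ({X : Set α | X ⊆ M.E ∧ M.eRk X ≤ ((5 + 1 : ℕ) : ℕ∞)}.ncard : ℚ) := by
    have : (((23 + d).choose (23 - 1) : ℕ) : ℚ) ≤ (Matroid.midCount M 23 6 : ℚ) +
        ({X : Set α | X ⊆ M.E ∧ M.eRk X ≤ (6 : ℕ)}.ncard : ℚ) := by exact_mod_cast hY
    exact this
  -- (Φ) and the numeral
  have hΦ := phiK_le_two_pow_div_six 23
  have hnum := regII_basis_23_numeral (23 + d) (by omega)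
  have hU0 : (0 : ℚ) ≤ (Matroid.topCount M 23 6 : ℚ) := Nat.cast_nonneg _
  have hΦ0 : (0 : ℚ) ≤ (2 : ℚ) ^ (23 + 6) / (((23 + 6).choose 6 : ℕ) : ℚ) :=
    div_nonneg (pow_nonneg (by norm_num) _) (Nat.cast_nonneg _)
  rw [RLS_iff]
  have h23 : (23 : ℕ) - 1 = 22 := rfl
  rw [h23] at hYq
  have hstep : phiK 23 6 * (Matroid.topCount M 23 6 : ℚ) ≤
      ((2 : ℚ) ^ (23 + 6) / (((23 + 6).choose 6 : ℕ) : ℚ)) *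
        ((91625857660 / 236379 : ℚ) * (((23 + d).choose 6 : ℕ) : ℚ)) := mul_le_mul hΦ hUq hU0 hΦ0
  generalize hc : (2 : ℚ) ^ (23 + 6) / (((23 + 6).choose 6 : ℕ) : ℚ) = c at hstep hnum
  generalize hA : ({X : Set α | X ⊆ M.E ∧ M.eRk X ≤ ((5 + 1 : ℕ) : ℕ∞)}.ncard : ℚ) = A at hYq hAq
  generalize hT : (1 + ((23 + d : ℕ) : ℚ) + (4 / 3 : ℚ) * (((23 + d).choose 2 : ℕ) : ℚ) +
      (14 / 5 : ℚ) * (((23 + d).choose 3 : ℕ) : ℚ) + (64 / 7 : ℚ) * (((23 + d).choose 4 : ℕ) : ℚ) +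
      (216355 / 2223 : ℚ) * (((23 + d).choose 5 : ℕ) : ℚ)) = T at hnum hAq
  generalize hC6 : (91625857660 / 236379 : ℚ) * (((23 + d).choose 6 : ℕ) : ℚ) = C6 at hstep hnum hAq
  generalize hC23 : (((23 + d).choose 22 : ℕ) : ℚ) = C23 at hnum hYq
  generalize hmid : (Matroid.midCount M 23 6 : ℚ) = mid at hYq ⊢
  linarith [hstep, hnum, hYq, hAq]

end ThmN

end PercRepro
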